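import Summits.BirchSwinnertonDyer.BirchSwinnertonDyer.Theorems.SchneiderFreeAdditiveX3BranchIMCIsogenyTransport
import Summits.BirchSwinnertonDyer.BirchSwinnertonDyer.Theorems.SchneiderFreeAdditiveX3Defs
import Summits.BirchSwinnertonDyer.Rank1Residual.X11b.AnticyclotomicEmbedding
import Literature.NumberTheory.EllipticCurves.KellerYin2024.PotentiallyGoodOrdinaryIwasawaTheory
import Literature.NumberTheory.EllipticCurves.Castella2018.AnticyclotomicSelmerDualModuleFinite
import HarnessLib

/-!
# Route `SchneiderFreeAdditiveX3` (K1 door), crux `GordTwoBranchIMC` (stmt-BirchSwinnertonDyer-19177):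
# H3 at the frame — `Ch_Λ(X_ac^∅(E_K[p^∞]))·R₀⟦T⟧ ⊆ (L)` — READ FROM Keller–Yin Thm. 3.5.1 (the typed
# under-review claim `KellerYin2024.thm351_imc_isTorsion_mu_zero_charIdeal_eq_OPEN`) at the CONJUGATE slot

Cell `bsd-schneider-ideate`, seat `bsd-schneider-door-c3` (prover, generation 7). HONEST FRAMING: this
file proves NO new mathematics about BSD. It is the KY-READING of the divisibility half `h3` of the
registered stub `stub_KYCH` of crux r3 (door-c3 gen 6, `gordTwoBranchIMC_of_facts_of_rebasedFrameInput`):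
the statement `(XAc.charIdeal (W_K) p κ 𝔭 ∅ γ).map (toUnr p) ≤ (L)` (Greenberg/BDP module STRICT AT
THE SOCKET'S PRIME `𝔭`) is DERIVED from

* the littype transcription of Keller–Yin arXiv:2410.23241 Thm. 3.5.1 (`thm351_…_OPEN`, a
  `[claim … under-review]` `Prop`, NEVER a theorem of the tree — taken as the hypothesis `hKY`), read
  with `(v, v̄) := (𝔭′, 𝔭)`: the embedding datum `ι′` induces the CONJUGATE prime `𝔭′`, the module is
  strict at `v̄ = 𝔭` (= ours), and the frame is a `p`-adic `L`-function of the branch AT `𝔭′`,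
  `IsBDPLFunction ι′ 𝔭′ κ γ f Ω_K Ω_p L` (planner memo `KY24b-anatomy-P2-g12.md` §2 "F-slot", §6b:
  no `(L) = (L^ι)` claim is needed — the value side is read at `𝔭` through door-c5's
  `sq_logOmega_embAt_eq_of_rank_one`);
* Keller–Yin's PER-CURVE hypotheses placed on a GOOD MEMBER `W₁` of the `ℚ`-isogeny class of `W`
  (gap F-W / K-W: `W₁` in Case (I) with `E₁[p]` reducible, a rational `p`-line non-trivial on the
  decomposition groups at `p`, `E₁(K)[p] = 0`, conductor `N`), transported to `W` along the isogeny
  by door-c3 gen 4/5's `xac_charIdeal_map_le_of_ratIsogeny` (`μ(X_ac(W₁)) = 0` is KY (ii));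
* the frame clause `¬ C p ∣ L` (gap F-mu: KY give `(L₀) = Char·R₀` with `L = p^c L₀`; the door needs
  `c = 0`), and `d_K ≠ −3` (gap F-dK, KY Assumption 2.0.3).

Bookkeeping supplied here: `p` SPLITS in `K` from the socket's degree-one prime (§1), the structure
map `toUnr` satisfies KY's `hj` (`coe_toUnr`), the Summits/Literature `X_ac` objects agree (`rfl`).
CONDITIONAL on `hKY`; nothing asserted about BSD; the crux stays OPEN; `--supports` item 19177.

References: Keller–Yin arXiv:2410.23241 Def. 3.4.1, Thm. 3.5.1, Rem. 3.5.2 (pp. 19–20);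
Castella–Grossi–Lee–Skinner, Invent. Math. 227 (2022) §2.3; Castella, Camb. J. Math. 6 (2018) Def. 2.2;
Marcus, *Number Fields*, Ch. 3 Thm. 25.
-/

noncomputable section

open scoped Classical

open WeierstrassCurve NumberField IsDedekindDomain Field PowerSeries
  Literature.NumberTheory.EllipticCurves
  Literature.NumberTheory.EllipticCurves.ModularForms
  Literature.NumberTheory.EllipticCurves.GreenbergSelmer
  Literature.NumberTheory.EllipticCurves.Rank1Residual
  Literature.NumberTheory.EllipticCurves.KellerYin2024
  Summit.BirchSwinnertonDyer.Rank1Residual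
  Summit.BirchSwinnertonDyer.Rank1Residual.X11b
  Summit.BirchSwinnertonDyer.Rank1Residual.X11b.AcSelmer
  Summit.BirchSwinnertonDyer.Rank1Residual.X11b.Halves

-- D-0017 layout: summit = sub-problem, so `Summit.BirchSwinnertonDyer.BirchSwinnertonDyer.…` is the
-- mandated namespace (same option as the route's sockets files).
set_option linter.dupNamespace false
set_option autoImplicit false

namespace Summit.BirchSwinnertonDyer.BirchSwinnertonDyer.Theorems.SchneiderFree

/-! ## §1 A degree-one prime above `p` in a quadratic field forces `p` to split -/

/-- **`p` splits in the quadratic field `K` as soon as ONE prime `𝔭 ∋ p` of `𝓞_K` has `e(𝔭|p) =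
f(𝔭|p) = 1`** (the fundamental identity `Σ e_i f_i = 2`: the inert and ramified cases have a single
prime with `(e, f) = (1, 2)`, resp. `(2, 1)`; tree `placesOver_trichotomy_of_finrank_eq_two`). This is
Keller–Yin's standing "`p = v v̄` splits in `K`" (`PotOrdSetting.split`) read off the socket's frame
`(𝔭, he, hf)`. [cite: KellerYin2024b, Assumption 2.0.3 (arXiv:2410.23241 p. 8)] -/
theorem ncard_primesOver_eq_two_of_degreeOne {K : Type} [Field K] [NumberField K]
    (h2 : Module.finrank ℚ K = 2) {p : ℕ} [Fact p.Prime] {𝔭 : HeightOneSpectrum (𝓞 K)}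
    (h𝔭 : ((p : ℕ) : 𝓞 K) ∈ 𝔭.asIdeal) (he : 𝔭.asIdeal.ramificationIdx (𝓞 ℚ) = 1)
    (hf : 𝔭.asIdeal.inertiaDeg (𝓞 ℚ) = 1) :
    ((Ideal.span {(p : ℤ)}).primesOver (𝓞 K)).ncard = 2 := by
  have hv := under_eq_ratPlace_of_mem h𝔭
  have hcard : ((Ideal.span {(p : ℤ)}).primesOver (𝓞 K)).ncard =
      {w : HeightOneSpectrum (𝓞 K) | w.under (𝓞 ℚ) = ratPlace p}.ncard := by
    rw [← ncard_primesOver_span_eq K (ratPlace p), primesEquiv_ratPlace]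
  rw [hcard]
  rcases placesOver_trichotomy_of_finrank_eq_two K h2 (ratPlace p) with
    ⟨w₁, w₂, hne, hset, -⟩ | ⟨w, hset, -, hf2⟩ | ⟨w, hset, he2, -⟩
  · rw [hset, Set.ncard_pair hne]
  · exfalso
    have hw : 𝔭 = w := by
      have : 𝔭 ∈ ({w' : HeightOneSpectrum (𝓞 K) | w'.under (𝓞 ℚ) = ratPlace p}) := hv
      rw [hset] at this
      exact this
    rw [hw] at hf
    omega
  · exfalso
    have hw : 𝔭 = w := by
      have : 𝔭 ∈ ({w' : HeightOneSpectrum (𝓞 K) | w'.under (𝓞 ℚ) = ratPlace p}) := hv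
      rw [hset] at this
      exact this
    rw [hw] at he
    omega

/-! ## §2 Keller–Yin's standing data assembled from the door's socket data (for a curve carrying KY's per-curve hypotheses) -/

/-- **`PotOrdSetting` from socket data.** For `W₁/ℚ` globally minimal elliptic in Case (I)
(`HasGoodOrdinaryReductionOverQuadraticAt`, on the door's cell this is
`hasGoodOrdinaryReductionOverQuadraticAt_of_subGordTwo`) with `E₁[p]` reducible, KY's lattice
normalisation (a rational `p`-line non-trivial on the decomposition groups at `p`) and
`E₁(K)[p] = 0`, conductor `N`; `K` imaginary quadratic of odd discriminant `≠ −3` satisfying the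
Heegner hypothesis for `N`; `κ` anticyclotomic; `𝔭 ∋ p` of degree one (so `p` splits, §1) and a
second prime `𝔭′ ∋ p`, `𝔭′ ≠ 𝔭`, induced by the embedding datum `ι′` (`BranchInducesPrime p ι′ 𝔭′`):
the littype's `PotOrdSetting ι′ W₁ K 𝔭′ 𝔭 κ N` holds — `v := 𝔭′` (the frame's prime), `v̄ := 𝔭`
(the strict prime of `𝔛`, OUR socket's prime). Pure repackaging; nothing asserted.
[cite: KellerYin2024b, Assumption 2.0.3, §3.1 Case (I), §3.3 ¶1, Def. 3.4.1 (arXiv:2410.23241 pp. 8, 13, 17, 19)] -/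
theorem potOrdSetting_of_socketData {p : ℕ} [hp : Fact p.Prime] (hp2 : p ≠ 2)
    (ι' : PadicAlgCl p ≃+* ℂ) (W₁ : WeierstrassCurve ℚ) [W₁.IsElliptic] [W₁.IsGloballyMinimal]
    (K : Type) [Field K] [NumberField K] (𝔭 𝔭' : HeightOneSpectrum (𝓞 K)) (κ : ZpExtension K p)
    (N : ℕ) (hN₁ : W₁.conductorNorm ℤ = N) (hcase₁ : W₁.HasGoodOrdinaryReductionOverQuadraticAt p)
    (hred₁ : Red W₁ p)
    (hlat₁ : ∃ Φ : AddSubgroup (geomTorsion W₁ (p : ℤ)),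
      IsRationalLine W₁ p Φ ∧ ¬ LineDecompositionTrivialAt W₁ p Φ)
    (htf₁ : ∀ Q : (W₁.baseChange K).toAffine.Point, p • Q = 0 → Q = 0)
    (hK : IsImaginaryQuadratic K) (hHe : SatisfiesHeegnerHypothesis N K) (hodd : Odd (NumberField.discr K))
    (hdK : NumberField.discr K ≠ -3) (hκ : κ.IsAnticyclotomic)
    (h𝔭 : ((p : ℕ) : 𝓞 K) ∈ 𝔭.asIdeal) (he : 𝔭.asIdeal.ramificationIdx (𝓞 ℚ) = 1)
    (hf : 𝔭.asIdeal.inertiaDeg (𝓞 ℚ) = 1) (hne : 𝔭 ≠ 𝔭') (hι' : BranchInducesPrime p ι' 𝔭') :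
    PotOrdSetting ι' W₁ K 𝔭' 𝔭 κ N where
  level := hN₁
  two_lt := lt_of_le_of_ne hp.out.two_le (Ne.symm hp2)
  caseOne := hcase₁
  red := hred₁
  lattice := hlat₁
  torsionFree := htf₁
  imagQuad := hK
  heegner := hHe
  odd := hodd
  ne_neg_three := hdK
  split := ncard_primesOver_eq_two_of_degreeOne hK.1 h𝔭 he hf
  induces := hι'
  mem_vbar := h𝔭
  vbar_ne := hne
  anticyclotomic := hκ

/-! ## §3 H3 at the frame from Thm. 3.5.1 (typed, OPEN), read at the conjugate slot and transported along the isogeny -/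

/-- Bridge: the Summits-side `X_ac` IS the Literature-side one (`X11b.AcSelmer.XAc` = multr1's copy,
`Literature.…Castella2018.AcSelmer.XAc` = the re-homed construction the KY transcription is stated
on); the characteristic ideals agree definitionally (companion of the tree's
`AcSelmer.hasCharValuationAt_iff_literature`, which is `Iff.rfl`). [cite: Castella2018, Def. 2.2 (arXiv:1704.06608 p. 5)] -/
theorem xac_charIdeal_eq_literature {K : Type} [Field K] [NumberField K] (V : WeierstrassCurve K)
    (p : ℕ) [Fact p.Prime] (κ : ZpExtension K p) (𝔭 : HeightOneSpectrum (𝓞 K))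
    (S : Set (HeightOneSpectrum (𝓞 K))) (γ : absoluteGaloisGroup K) [Fact (κ.IsTopGenerator γ)] :
    XAc.charIdeal V p κ 𝔭 S γ =
      Literature.NumberTheory.EllipticCurves.Castella2018.AcSelmer.XAc.charIdeal V p κ 𝔭 S γ := by
  unfold XAc.charIdeal Literature.NumberTheory.EllipticCurves.Castella2018.AcSelmer.XAc.charIdeal
  rfl

/-- **H3 at the frame ⇐ Keller–Yin Thm. 3.5.1 (typed, OPEN) + a good member + the `μ`-clause.**
Data: an elliptic `W/ℚ` with `f` its newform of level `N`; a number field `K`, imaginary quadratic of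
odd discriminant `d_K ≠ −3` with the Heegner hypothesis for `N`; an anticyclotomic `κ` with
topological generator `γ`; the socket's degree-one prime `𝔭 ∋ p` (`p` odd) and a second prime
`𝔭′ ∋ p`, `𝔭′ ≠ 𝔭`, induced by `ι′`; a frame `(Ω_K ≠ 0, Ω_p ≠ 0, L)` of the branch AT `𝔭′`,
`IsBDPLFunction ι′ 𝔭′ κ γ f Ω_K Ω_p L`, with `¬ p ∣ L` in `R₀⟦T⟧`; and a GOOD MEMBER `W₁` of the
isogeny class: a `ℚ`-isogeny `φ : W₁ → W` of degree `p^m·d`, `p ∤ d`, `W₁` globally minimal of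
conductor `N` in Case (I) with `E₁[p]` reducible, KY's lattice normalisation and `E₁(K)[p] = 0`.
If `X_ac^∅(W_K)` (strict at `𝔭`) is `Λ`-torsion (on the door: CTL₀), then
`Ch_Λ(X_ac^∅(W_K))·R₀⟦T⟧ ⊆ (L)` — the `h3` of `stub_KYCH` for this `L`. Proof: `PotOrdSetting ι′ W₁ K
𝔭′ 𝔭 κ N` (§2); `f` is the newform of `W₁` (`IsNewformOf.of_isIsogenous`); Thm. 3.5.1 for `W₁` gives
torsion, `μ = 0` and — since `p ∤ L` — `Ch_Λ(X_ac(W₁,K))·R₀⟦T⟧ = (L)` along `toUnr`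
(`charIdeal_map_eq_span_of_thm351_OPEN_of_not_dvd`, `hj` = `coe_toUnr`); the divisibility descends
to `W` along `φ` (`xac_charIdeal_map_le_of_ratIsogeny`, `X_ac` finitely generated by
`XAc.module_finite_empty`). CONDITIONAL on the OPEN preprint claim `hKY`; nothing asserted about BSD.
[cite: KellerYin2024b, Thm. 3.5.1 and Rem. 3.5.2 (arXiv:2410.23241 p. 20) (preprint; taken as hypothesis)]
[cite: Castella2018, Def. 2.2 (arXiv:1704.06608 p. 5)] -/
theorem xac_charIdeal_map_le_of_KY_OPEN (hKY : thm351_imc_isTorsion_mu_zero_charIdeal_eq_OPEN)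
    {p : ℕ} [hp : Fact p.Prime] (hp2 : p ≠ 2)
    {W : WeierstrassCurve ℚ} [W.IsElliptic] {N : ℕ} [NeZero N]
    {f : CuspForm (CongruenceSubgroup.Gamma0 N) 2} (hfW : IsNewformOf W f)
    {K : Type} [Field K] [NumberField K] (hK : IsImaginaryQuadratic K)
    (hHe : SatisfiesHeegnerHypothesis N K) (hodd : Odd (NumberField.discr K))
    (hdK : NumberField.discr K ≠ -3)
    {κ : ZpExtension K p} (hκ : κ.IsAnticyclotomic) (γ : absoluteGaloisGroup K)
    [Fact (κ.IsTopGenerator γ)]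
    {𝔭 : HeightOneSpectrum (𝓞 K)} (h𝔭 : ((p : ℕ) : 𝓞 K) ∈ 𝔭.asIdeal)
    (he : 𝔭.asIdeal.ramificationIdx (𝓞 ℚ) = 1) (hf : 𝔭.asIdeal.inertiaDeg (𝓞 ℚ) = 1)
    {𝔭' : HeightOneSpectrum (𝓞 K)} (hne : 𝔭 ≠ 𝔭') {ι' : PadicAlgCl p ≃+* ℂ}
    (hι' : BranchInducesPrime p ι' 𝔭')
    {ΩK : ℂ} {Ωp : ℂ_[p]} {L : UnrSeries p} (hΩK : ΩK ≠ 0) (hΩp : Ωp ≠ 0)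
    (hL : IsBDPLFunction ι' 𝔭' κ γ f ΩK Ωp L) (hμL : ¬ C (p : unrIntegers p) ∣ L)
    -- the good member of the isogeny class
    {W₁ : WeierstrassCurve ℚ} [W₁.IsElliptic] [W₁.IsGloballyMinimal]
    (φ : WeierstrassCurve.Isogeny W₁ W) {m d : ℕ} (hdeg : φ.degree = p ^ m * d) (hd : ¬ p ∣ d)
    (hN₁ : W₁.conductorNorm ℤ = N) (hcase₁ : W₁.HasGoodOrdinaryReductionOverQuadraticAt p)
    (hred₁ : Red W₁ p)
    (hlat₁ : ∃ Φ : AddSubgroup (geomTorsion W₁ (p : ℤ)),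
      IsRationalLine W₁ p Φ ∧ ¬ LineDecompositionTrivialAt W₁ p Φ)
    (htf₁ : ∀ Q : (W₁.baseChange K).toAffine.Point, p • Q = 0 → Q = 0)
    -- torsion of the target module (on the door: the control corner's CTL₀)
    (hT : Module.IsTorsion (IwasawaAlgebra p) (XAc (W.baseChange K) p κ 𝔭 ∅ γ)) :
    (XAc.charIdeal (W.baseChange K) p κ 𝔭 ∅ γ).map (PowerSeries.map (toUnr p)) ≤ Ideal.span {L} := by
  -- Keller–Yin's standing data for the good member, at `(v, v̄) := (𝔭′, 𝔭)`
  have hS : PotOrdSetting ι' W₁ K 𝔭' 𝔭 κ N :=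
    potOrdSetting_of_socketData hp2 ι' W₁ K 𝔭 𝔭' κ N hN₁ hcase₁ hred₁ hlat₁ htf₁ hK hHe hodd hdK hκ
      h𝔭 he hf hne hι'
  -- `f` is the newform of `W₁`
  have hf₁ : IsNewformOf W₁ f := hfW.of_isIsogenous ⟨φ⟩
  -- Thm. 3.5.1 for `W₁`: torsion, `μ = 0`, and the equality along `toUnr` (slack `c = 0` as `p ∤ L`)
  obtain ⟨hT₁, hμ₁, -⟩ := hKY ι' W₁ K 𝔭' 𝔭 κ γ hf₁ hS
  have heq := charIdeal_map_eq_span_of_thm351_OPEN_of_not_dvd hKY ι' W₁ K 𝔭' 𝔭 κ γ hf₁ hS hΩK hΩp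
    hL hμL (toUnr p) (coe_toUnr p)
  have hdiv₁ : (XAc.charIdeal (W₁.baseChange K) p κ 𝔭 ∅ γ).map (PowerSeries.map (toUnr p)) ≤
      Ideal.span {L} := by
    rw [xac_charIdeal_eq_literature, heq]
  -- descend along the isogeny (finite generation is unconditional; torsion of the target = `hT`)
  haveI : Module.Finite (IwasawaAlgebra p) (XAc (W₁.baseChange K) p κ 𝔭 ∅ γ) :=
    Literature.NumberTheory.EllipticCurves.Castella2018.AcSelmer.XAc.module_finite_empty _ p κ 𝔭 γ
  haveI : Module.Finite (IwasawaAlgebra p) (XAc (W.baseChange K) p κ 𝔭 ∅ γ) :=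
    Literature.NumberTheory.EllipticCurves.Castella2018.AcSelmer.XAc.module_finite_empty _ p κ 𝔭 γ
  exact xac_charIdeal_map_le_of_ratIsogeny κ 𝔭 ∅ γ φ hdeg hd hT₁ hT hμ₁ (PowerSeries.map (toUnr p))
    hdiv₁

/-! ## §4 (append) The case `W₁ = W`: the curve itself carries Keller–Yin's per-curve hypotheses -/

/-- **H3 at the frame ⇐ Thm. 3.5.1 (typed, OPEN) when the curve ITSELF is Keller–Yin-normalised** — no
isogeny transport and no torsion input: if `W` (globally minimal, conductor `N`, newform `f`) is in
Case (I) with `E[p]` reducible, has a rational `p`-line non-trivial on the decomposition groups at `p`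
and `E(K)[p] = 0`, then for every frame `L` of the branch AT the conjugate prime `𝔭′` with `p ∤ L`,
`Ch_Λ(X_ac^∅(W_K))·R₀⟦T⟧ ⊆ (L)` at OUR prime `𝔭` (indeed `=`, by KY (iii) with slack `c = 0`).
This is the reading most pairs of the cell will use (the listed curve is usually a good member);
`xac_charIdeal_map_le_of_KY_OPEN` is the general transported form. CONDITIONAL on the OPEN preprint
claim `hKY`; nothing asserted about BSD.
[cite: KellerYin2024b, Thm. 3.5.1 (arXiv:2410.23241 p. 20) (preprint; taken as hypothesis)] -/
theorem xac_charIdeal_map_le_of_KY_OPEN_self (hKY : thm351_imc_isTorsion_mu_zero_charIdeal_eq_OPEN)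
    {p : ℕ} [hp : Fact p.Prime] (hp2 : p ≠ 2)
    {W : WeierstrassCurve ℚ} [W.IsElliptic] [W.IsGloballyMinimal] {N : ℕ} [NeZero N]
    {f : CuspForm (CongruenceSubgroup.Gamma0 N) 2} (hfW : IsNewformOf W f)
    {K : Type} [Field K] [NumberField K] (hK : IsImaginaryQuadratic K)
    (hHe : SatisfiesHeegnerHypothesis N K) (hodd : Odd (NumberField.discr K))
    (hdK : NumberField.discr K ≠ -3)
    {κ : ZpExtension K p} (hκ : κ.IsAnticyclotomic) (γ : absoluteGaloisGroup K)
    [Fact (κ.IsTopGenerator γ)]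
    {𝔭 : HeightOneSpectrum (𝓞 K)} (h𝔭 : ((p : ℕ) : 𝓞 K) ∈ 𝔭.asIdeal)
    (he : 𝔭.asIdeal.ramificationIdx (𝓞 ℚ) = 1) (hf : 𝔭.asIdeal.inertiaDeg (𝓞 ℚ) = 1)
    {𝔭' : HeightOneSpectrum (𝓞 K)} (hne : 𝔭 ≠ 𝔭') {ι' : PadicAlgCl p ≃+* ℂ}
    (hι' : BranchInducesPrime p ι' 𝔭')
    {ΩK : ℂ} {Ωp : ℂ_[p]} {L : UnrSeries p} (hΩK : ΩK ≠ 0) (hΩp : Ωp ≠ 0)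
    (hL : IsBDPLFunction ι' 𝔭' κ γ f ΩK Ωp L) (hμL : ¬ C (p : unrIntegers p) ∣ L)
    (hN : W.conductorNorm ℤ = N) (hcase : W.HasGoodOrdinaryReductionOverQuadraticAt p)
    (hred : Red W p)
    (hlat : ∃ Φ : AddSubgroup (geomTorsion W (p : ℤ)),
      IsRationalLine W p Φ ∧ ¬ LineDecompositionTrivialAt W p Φ)
    (htf : ∀ Q : (W.baseChange K).toAffine.Point, p • Q = 0 → Q = 0) :
    (XAc.charIdeal (W.baseChange K) p κ 𝔭 ∅ γ).map (PowerSeries.map (toUnr p)) ≤ Ideal.span {L} := by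
  have hS : PotOrdSetting ι' W K 𝔭' 𝔭 κ N :=
    potOrdSetting_of_socketData hp2 ι' W K 𝔭 𝔭' κ N hN hcase hred hlat htf hK hHe hodd hdK hκ h𝔭 he
      hf hne hι'
  have heq := charIdeal_map_eq_span_of_thm351_OPEN_of_not_dvd hKY ι' W K 𝔭' 𝔭 κ γ hfW hS hΩK hΩp
    hL hμL (toUnr p) (coe_toUnr p)
  rw [xac_charIdeal_eq_literature, heq]

/-- **… and then `X_ac^∅(W_K)` is `Λ`-torsion with `μ = 0`** (KY (i)–(ii) for the curve itself, at the
strict prime `𝔭`; the Summits-side module is the Literature one by `rfl`). CONDITIONAL on `hKY`.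
[cite: KellerYin2024b, Thm. 3.5.1 (arXiv:2410.23241 p. 20) (preprint; taken as hypothesis)] -/
theorem xac_isTorsion_and_mu_eq_zero_of_KY_OPEN_self
    (hKY : thm351_imc_isTorsion_mu_zero_charIdeal_eq_OPEN)
    {p : ℕ} [hp : Fact p.Prime] (hp2 : p ≠ 2)
    {W : WeierstrassCurve ℚ} [W.IsElliptic] [W.IsGloballyMinimal] {N : ℕ} [NeZero N]
    {f : CuspForm (CongruenceSubgroup.Gamma0 N) 2} (hfW : IsNewformOf W f)
    {K : Type} [Field K] [NumberField K] (hK : IsImaginaryQuadratic K)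
    (hHe : SatisfiesHeegnerHypothesis N K) (hodd : Odd (NumberField.discr K))
    (hdK : NumberField.discr K ≠ -3)
    {κ : ZpExtension K p} (hκ : κ.IsAnticyclotomic) (γ : absoluteGaloisGroup K)
    [Fact (κ.IsTopGenerator γ)]
    {𝔭 : HeightOneSpectrum (𝓞 K)} (h𝔭 : ((p : ℕ) : 𝓞 K) ∈ 𝔭.asIdeal)
    (he : 𝔭.asIdeal.ramificationIdx (𝓞 ℚ) = 1) (hf : 𝔭.asIdeal.inertiaDeg (𝓞 ℚ) = 1)
    {𝔭' : HeightOneSpectrum (𝓞 K)} (hne : 𝔭 ≠ 𝔭') {ι' : PadicAlgCl p ≃+* ℂ}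
    (hι' : BranchInducesPrime p ι' 𝔭')
    (hN : W.conductorNorm ℤ = N) (hcase : W.HasGoodOrdinaryReductionOverQuadraticAt p)
    (hred : Red W p)
    (hlat : ∃ Φ : AddSubgroup (geomTorsion W (p : ℤ)),
      IsRationalLine W p Φ ∧ ¬ LineDecompositionTrivialAt W p Φ)
    (htf : ∀ Q : (W.baseChange K).toAffine.Point, p • Q = 0 → Q = 0) :
    Module.IsTorsion (IwasawaAlgebra p) (XAc (W.baseChange K) p κ 𝔭 ∅ γ) ∧
      muInvariant p (XAc (W.baseChange K) p κ 𝔭 ∅ γ) = 0 := by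
  have hS : PotOrdSetting ι' W K 𝔭' 𝔭 κ N :=
    potOrdSetting_of_socketData hp2 ι' W K 𝔭 𝔭' κ N hN hcase hred hlat htf hK hHe hodd hdK hκ h𝔭 he
      hf hne hι'
  obtain ⟨hT, hμ, -⟩ := hKY ι' W K 𝔭' 𝔭 κ γ hfW hS
  exact ⟨hT, hμ⟩

end Summit.BirchSwinnertonDyer.BirchSwinnertonDyer.Theorems.SchneiderFree

end
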